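/-
Copyright (c) 2026 the pub-hodgecm-mathlib formalisation cell (harness21).  Prover seat hodgecm-mathlib-K2E3-p37 (g0), Track B «K2-LIT» ∕ h413 =
`stmt-HodgeConjecture-24833`, line `K2_E3_EllipticInputs`, unit U4 «Keys», PART «U4Keys» socket :182 (U4f-χ₁-ram-one-pos)
`sig_K2E3KeysThmTwoContractingRamifiedCharOnePosDepth` (LINE-LEAD K2E3-plan (g4) L4∕E3 EMIT #5 deal D163 2026-09-04T15:31:56Z; R0 census + addenda §6–§9
`K2/K2E3-p37/g0/CENSUS-U4f-PosDepth.K2E3-p37-g0.md`): programme A_pos brick (iii)-alg «THE ENTRIES OF `ū(x,z)⁻¹ · u(y,b) · ū(x,z)`» — the exact 3 × 3 algebra behind the DEPTH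
WITNESSES on the intermediate cells (memo §7∕§9), over any field with an involution.  REPORT-FIRST 2026-09-04.
-/
import Summits.HodgeConjecture.HodgeConjecture.Theorems.K2E3LowerUnipotentBigCellIntegral   -- ★ p861613 (this seat): `exists_upper_of_rel` (`u(a,b) ∈ N`); brings ★ BigCell (`exists_coe_eq_lower`, `coe_inv_apply_eq`)
import HarnessLib

/-!
# K2 ∕ E3 «EllipticInputs», unit U4 «Keys» — (U4f-χ₁-ram-one-pos), programme A_pos brick (iii)-alg: THE ENTRIES OF `j = ū(x,z)⁻¹ · u(y,b) · ū(x,z)` IN `U(σ, Φ₃)(K)`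
# «`j₀₀ = 1 − yσx + bz`, `j₁₀ = −y(σx)² + σx·b·z − σy·z`, `j₂₀ = σz·b·z + x·σy·z − σz·y·σx`, `j₂₁ = σz·y + σz·b·x + x²·σy`»   [Roche1998 §4; Casselman1995 §6.3; Rogawski1990 §1.10]

Cell hodgecm-mathlib, Track B «K2-LIT», crux item H413 = stmt-HodgeConjecture-24833 (route `HCCMUnconditional`, no route verbs); target BY NAME the OPEN tier-0 leaf
`…K2E3EllipticInputs.U4Keys.sig_K2E3KeysThmTwoContractingRamifiedCharOnePosDepth` (U4Keys ED. 8 :182), design D-I «vanishing functional» at POSITIVE depth.  Author K2E3-p37 (g0).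
`--supports stmt-HodgeConjecture-24833 --as helper`; THEOREMS ONLY; MODEL level (`U(σ, Φ₃)(K)`, `K` any field, `σ` an involution `hσ`).  NOT THE PAYER of :182.

THE POINT.  In the cell-family engine ★ p861573 with `R = N̄ ∖ J_n`, a lower unipotent `n̄ = ū(x, z)` OFF the level-`n` Iwahori `J_n` and OFF the big cell (`|z| < 1`) must carry a
DEPTH WITNESS: some `p ∈ B` with `j := n̄⁻¹ p n̄ ∈ J_n` and `θ(j) ≠ (χδ^{½})(p)`.  Testing `p = u(y, b) ∈ N` (so `(χδ^{½})(p) = 1` and `θ(j) = χ₁(j₀₀)`), everything reduces to the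
four entries of `j = ū(x,z)⁻¹ u(y,b) ū(x,z)` that the level-`n` test ★ `mem_glInt_inf_conj_glInt_pow_iff` and the character ★ `theta_mul_pow` read: `(0,0)` and the three strictly-lower
ones.  THIS FILE computes them EXACTLY (no valuation, any field): with `ū(x,z) = !![1,0,0; −σx,1,0; z,x,1]`, `ū⁻¹ = ū(−x, σz) = !![1,0,0; σx,1,0; σz,−x,1]` (★ `coe_inv_apply_eq`) and
`u(y,b) = !![1,y,b; 0,1,−σy; 0,0,1]`:
  `j₀₀ = 1 − yσx + bz`,  `j₁₀ = −y(σx)² + σx·b·z − σy·z`,  `j₂₀ = σz·b·z + x·σy·z − σz·y·σx` (after `z + σz + xσx = 0`),  `j₂₁ = σz·y + σz·b·x + x²·σy`.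
The two WITNESS FAMILIES of memo §9 then follow by valuation bookkeeping (next file): (X) `y = −c∕σx`, `b = −yσy∕2` gives `j₀₀ = 1 + c + bz`; (Z) `y = 0`, `b = c(z⁻¹ − (σz)⁻¹)∕2`
(`σc = c`) gives `j₀₀ = 1 + c + c·xσx∕(2σz)`; in both, `χ₁(j₀₀) = χ₁(1 + c) ≠ 1` once the error terms lie in `𝔭ⁿ` and `χ₁(1 + c) ≠ 1` (exact conductor `n`, resp. exact
`F`-conductor `n`).
* §1 `coe_inv_lower_eq` (the matrix of `ū(x,z)⁻¹`), **`conj_upper_apply_zero_zero`**, **`conj_upper_apply_one_zero`**, **`conj_upper_apply_two_zero`**, **`conj_upper_apply_two_one`**.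
* §2 `conj_upper_apply_zero_zero_of_familyX` (`y·σx = −c ⟹ j₀₀ = 1 + c + bz`), `conj_upper_lower_entries_of_y_eq_zero` (family Z: `j₁₀ = σx·b·z`, `j₂₀ = σz·b·z`, `j₂₁ = σz·b·x`).
HONEST LABEL: HC_CM is proved only modulo the 7 printed citations (2 remaining named inputs: hLiu418 = stmt-HodgeConjecture-24832, h413 = stmt-HodgeConjecture-24833)
until rung 0 closes; count-neutral — this file does NOT pay the leaf; no printed citation is discharged.

## References
* [Roche1998] A. Roche, *Types and Hecke algebras for principal series representations of split reductive p-adic groups*, Ann. Sci. ÉNS (4) 31 (1998), §4 (support of `χ̃`-spherical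
  vectors: the relevance test on `J ∩ g⁻¹Pg`).
* [Casselman1995] W. Casselman, *Introduction to the theory of admissible representations of `p`-adic reductive groups* (1995), §6.3.
* [Rogawski1990] J. D. Rogawski, *Automorphic Representations of Unitary Groups in Three Variables*, Ann. of Math. Stud. 123 (1990), §1.9–§1.10 pp. 8–9.
-/

set_option autoImplicit false
-- the mandated namespace repeats the single-problem summit's segment (`HodgeConjecture.HodgeConjecture`)
set_option linter.dupNamespace false

noncomputable section

open Matrix Literature.NumberTheory.Automorphic Literature.NumberTheory.Automorphic.UnitaryGroup
open scoped Matrix MatrixGroups Pointwise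

namespace Summit.HodgeConjecture.HodgeConjecture.Cruxes.H413.K2E3LowerUnipotentConjUpperEntries

open Summit.HodgeConjecture.HodgeConjecture.Cruxes.H413

variable {K : Type*} [Field K] (σ : K →+* K) {J : Matrix (Fin 3) (Fin 3) K} (hJ : J = (StdForm.antidiagonal 3).over K)
  (hσ : ∀ a, σ (σ a) = a)
  {nb u : ↥(unitaryGroupOfForm σ J)} {x z y b : K}
  (hnb : ((nb : GL (Fin 3) K) : Matrix (Fin 3) (Fin 3) K) = !![1, 0, 0; -σ x, 1, 0; z, x, 1])
  (hu : ((u : GL (Fin 3) K) : Matrix (Fin 3) (Fin 3) K) = !![1, y, b; 0, 1, -σ y; 0, 0, 1])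

/-! ## §1 The four entries of `j = ū⁻¹ u ū` -/

include hJ hσ hnb in
/-- **The matrix of `ū(x, z)⁻¹` is `ū(−x, σz) = !![1,0,0; σx,1,0; σz,−x,1]`** (`(g⁻¹)ᵢⱼ = σ(g_{rev j, rev i})`, ★ `coe_inv_apply_eq`). [cite: Rogawski1990, §1.9 p. 8] -/
theorem coe_inv_lower_eq :
    (((nb⁻¹ : ↥(unitaryGroupOfForm σ J)) : GL (Fin 3) K) : Matrix (Fin 3) (Fin 3) K) = !![1, 0, 0; σ x, 1, 0; σ z, -x, 1] := by
  ext i j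
  rw [coe_inv_apply_eq σ hJ nb i j, hnb]
  fin_cases i <;> fin_cases j <;> simp [hσ]

include hJ hσ hnb hu in
/-- The entries of `j = ū⁻¹ u ū` as explicit sums (`ū⁻¹`, `u`, `ū` by their matrices). [cite: Rogawski1990, §1.10 p. 9] -/
theorem conj_upper_apply (i k : Fin 3) :
    (((nb⁻¹ * u * nb : ↥(unitaryGroupOfForm σ J)) : GL (Fin 3) K) : Matrix (Fin 3) (Fin 3) K) i k =
      ((!![1, 0, 0; σ x, 1, 0; σ z, -x, 1] : Matrix (Fin 3) (Fin 3) K) * !![1, y, b; 0, 1, -σ y; 0, 0, 1] * !![1, 0, 0; -σ x, 1, 0; z, x, 1]) i k := by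
  rw [Subgroup.coe_mul, Subgroup.coe_mul, Units.val_mul, Units.val_mul, coe_inv_lower_eq σ hJ hσ hnb, hu, hnb]

include hJ hσ hnb hu in
/-- **`j₀₀ = 1 − yσx + bz`** for `j = ū(x,z)⁻¹ u(y,b) ū(x,z)` — the entry the character `θ(j) = χ₁(j₀₀)` reads (★ `theta_mul_pow`). [cite: Roche1998, §4] [cite: Casselman1995, §6.3] -/
theorem conj_upper_apply_zero_zero :
    (((nb⁻¹ * u * nb : ↥(unitaryGroupOfForm σ J)) : GL (Fin 3) K) : Matrix (Fin 3) (Fin 3) K) 0 0 = 1 - y * σ x + b * z := by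
  rw [conj_upper_apply σ hJ hσ hnb hu]
  simp [Matrix.mul_apply, Fin.sum_univ_three]
  ring

include hJ hσ hnb hu in
/-- **`j₁₀ = −y(σx)² + σx·b·z − σy·z`**. [cite: Roche1998, §4] [cite: Rogawski1990, §1.10 p. 9] -/
theorem conj_upper_apply_one_zero :
    (((nb⁻¹ * u * nb : ↥(unitaryGroupOfForm σ J)) : GL (Fin 3) K) : Matrix (Fin 3) (Fin 3) K) 1 0 = -(y * σ x * σ x) + σ x * b * z - σ y * z := by
  rw [conj_upper_apply σ hJ hσ hnb hu]
  simp [Matrix.mul_apply, Fin.sum_univ_three]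
  ring

include hJ hσ hnb hu in
/-- **`j₂₀ = σz·b·z + x·σy·z − σz·y·σx`** (the constant part `z + σz + xσx` vanishes by the relation of `ū(x,z)`). [cite: Roche1998, §4] [cite: Rogawski1990, §1.10 p. 9] -/
theorem conj_upper_apply_two_zero (hrel : z + σ z + x * σ x = 0) :
    (((nb⁻¹ * u * nb : ↥(unitaryGroupOfForm σ J)) : GL (Fin 3) K) : Matrix (Fin 3) (Fin 3) K) 2 0 = σ z * b * z + x * σ y * z - σ z * y * σ x := by
  rw [conj_upper_apply σ hJ hσ hnb hu]
  simp [Matrix.mul_apply, Fin.sum_univ_three]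
  linear_combination hrel

include hJ hσ hnb hu in
/-- **`j₂₁ = σz·y + σz·b·x + x²·σy`**. [cite: Roche1998, §4] [cite: Rogawski1990, §1.10 p. 9] -/
theorem conj_upper_apply_two_one :
    (((nb⁻¹ * u * nb : ↥(unitaryGroupOfForm σ J)) : GL (Fin 3) K) : Matrix (Fin 3) (Fin 3) K) 2 1 = σ z * y + σ z * b * x + x * x * σ y := by
  rw [conj_upper_apply σ hJ hσ hnb hu]
  simp [Matrix.mul_apply, Fin.sum_univ_three]
  ring

/-! ## §2 The two witness families of the census (memo §9): their `(0,0)` entry and, for `y = 0`, the lower entries -/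

include hJ hσ hnb hu in
/-- **Family X** (`y·σx = −c`, any `b`): `j₀₀ = 1 + c + bz` — so `θ(j) = χ₁((1 + c)(1 + bz∕(1+c)))`, and the witness disagrees as soon as `bz ∈ 𝔭ⁿ` and `χ₁(1 + c) ≠ 1`
(exact conductor `n`; valuation bookkeeping in the sequel). [cite: Roche1998, §4] -/
theorem conj_upper_apply_zero_zero_of_familyX {c : K} (hyc : y * σ x = -c) :
    (((nb⁻¹ * u * nb : ↥(unitaryGroupOfForm σ J)) : GL (Fin 3) K) : Matrix (Fin 3) (Fin 3) K) 0 0 = 1 + c + b * z := by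
  rw [conj_upper_apply_zero_zero σ hJ hσ hnb hu, hyc]
  ring

include hJ hσ hnb hu in
/-- **Family Z** (`y = 0`, `b` arbitrary, e.g. `b = c(z⁻¹ − (σz)⁻¹)∕2` imaginary for `σc = c`): `j₀₀ = 1 + bz`, `j₁₀ = σx·b·z`, `j₂₀ = σz·b·z`, `j₂₁ = σz·b·x` — the three lower entries
lie in `𝔭ⁿ` as soon as `|b·z| ≤ |ϖ|^{n−1}` and `|x|, |z| ≤ |ϖ|` (sequel). [cite: Roche1998, §4] -/
theorem conj_upper_entries_of_y_eq_zero (hrel : z + σ z + x * σ x = 0) (hy : y = 0) :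
    (((nb⁻¹ * u * nb : ↥(unitaryGroupOfForm σ J)) : GL (Fin 3) K) : Matrix (Fin 3) (Fin 3) K) 0 0 = 1 + b * z ∧
      (((nb⁻¹ * u * nb : ↥(unitaryGroupOfForm σ J)) : GL (Fin 3) K) : Matrix (Fin 3) (Fin 3) K) 1 0 = σ x * b * z ∧
      (((nb⁻¹ * u * nb : ↥(unitaryGroupOfForm σ J)) : GL (Fin 3) K) : Matrix (Fin 3) (Fin 3) K) 2 0 = σ z * b * z ∧
      (((nb⁻¹ * u * nb : ↥(unitaryGroupOfForm σ J)) : GL (Fin 3) K) : Matrix (Fin 3) (Fin 3) K) 2 1 = σ z * b * x := by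
  subst hy
  refine ⟨?_, ?_, ?_, ?_⟩
  · rw [conj_upper_apply_zero_zero σ hJ hσ hnb hu]; ring
  · rw [conj_upper_apply_one_zero σ hJ hσ hnb hu, map_zero]; ring
  · rw [conj_upper_apply_two_zero σ hJ hσ hnb hu hrel, map_zero]; ring
  · rw [conj_upper_apply_two_one σ hJ hσ hnb hu, map_zero]; ring

end Summit.HodgeConjecture.HodgeConjecture.Cruxes.H413.K2E3LowerUnipotentConjUpperEntries

end
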